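import Summits.AtomisticToContinuum.Statement
import Literature.MathematicalPhysics.KineticTheory.InfiniteChainDynamics
import Mathlib

/-!
# AtomisticToContinuum / FourierGreenKubo — assembly

Route `AtomisticToContinuum/FourierGreenKubo` (linear response / Green–Kubo line for the pinned
anharmonic chain), item `stmt-AtomisticToContinuum-0702` (assembly, formal shadow): clause (i) of
`OscillatorChain.FouriersLawFor` (existence and uniqueness of the weak steady state for all
`N, T_L, T_R > 0`) for all parameters, together with clause (ii) (a conductivity `κ > 0` such that
for every family of steady states the finite-`N` linear-response limits `D_N` exist and
`D_N → κ T`) for all parameters, give `Literature.MathematicalPhysics.KineticTheory.HeatConduction.FouriersLaw` — pure unfolding of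
`FouriersLaw`/`FouriersLawFor`. The route supplies (ii) from the finite-volume Kubo formula, the
infinite-volume Green–Kubo coefficient and the thermodynamic limit (informal items 0703/0704).
-/

namespace Literature.HeatConduction

/-- Settles `stmt-AtomisticToContinuum-0702` (route assembly of `AtomisticToContinuum/FourierGreenKubo`):
steady-state existence-and-uniqueness for all parameters and the linear-response clause for all
parameters assemble to `FouriersLaw` (definitional: `FouriersLaw` is the `∀`-closure of
`FouriersLawFor = (i) ∧ (ii)`). [folklore] -/
theorem fouriersLaw_of_steadyState_and_linearResponse :
    (∀ ω₂ lam β γ : ℝ, 0 < ω₂ → 0 < lam → 0 < β → 0 < γ → ∀ (N : ℕ) (T_L T_R : ℝ), 0 < T_L → 0 < T_R → ∃ μ : MeasureTheory.Measure (Literature.MathematicalPhysics.KineticTheory.HeatConduction.PhaseSpace N), (Literature.MathematicalPhysics.KineticTheory.HeatConduction.pinnedChain ω₂ lam β γ).IsSteadyState N T_L T_R μ ∧ ∀ ν : MeasureTheory.Measure (Literature.MathematicalPhysics.KineticTheory.HeatConduction.PhaseSpace N), (Literature.MathematicalPhysics.KineticTheory.HeatConduction.pinnedChain ω₂ lam β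 γ).IsSteadyState N T_L T_R ν → ν = μ) → (∀ ω₂ lam β γ : ℝ, 0 < ω₂ → 0 < lam → 0 < β → 0 < γ → ∃ κ : ℝ → ℝ, (∀ T, 0 < T → 0 < κ T) ∧ ∀ μ : (N : ℕ) → ℝ → ℝ → MeasureTheory.Measure (Literature.MathematicalPhysics.KineticTheory.HeatConduction.PhaseSpace N), (∀ (N : ℕ) (T_L T_R : ℝ), 0 < T_L → 0 < T_R → (Literature.MathematicalPhysics.KineticTheory.HeatConduction.pinnedChain ω₂ lam β γ).IsSteadyState N T_L T_R (μ N T_L T_R)) → ∀ T : ℝ, 0 < T → ∃ D : ℕ → ℝ, (∀ N : ℕ, Filter.Tendsto (fun δ : ℝ => (Literature.MathematicalPhysics.KineticTheory.HeatConduction.pinnedChain ω₂ lam β γ).totalCurrent (μ N (T + δ / 2) (T - δ / 2)) / δ) (nhdsWithin 0 {(0 : ℝ)}ᶜ) (nhds (D N))) ∧ Filter.Tendsto D Filter.atTop (nhds (κ T))) → Literature.MathematicalPhysics.KineticTheory.HeatConduction.FouriersLaw := by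
  intro h₁ h₂ ω₂ lam β γ hω hl hβ hγ
  exact ⟨h₁ ω₂ lam β γ hω hl hβ hγ, h₂ ω₂ lam β γ hω hl hβ hγ⟩

/-- Settles `stmt-AtomisticToContinuum-0736` (route assembly v2 of `AtomisticToContinuum/FourierGreenKubo`,
typed frame after `InfiniteChainDynamics`): (i) existence and uniqueness of the weak steady state
for all `N, T_L, T_R > 0` (item 0706) → (iii) for every `T > 0` a Gibbs state `μ_T` of the
infinite pinned chain and an infinite-volume dynamics `D` preserving `μ_T` with `HasGreenKubo`
(item 0703) → (ii)+(iv) under steady-state uniqueness, for every steady-state family and every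
such `(μ_T, D)`, the finite-`N` response limits `D_N` exist and `D_N → κ_GK(D, μ_T, T)` (item 0704)
→ `FouriersLaw`. Glue: `κ T := greenKuboConductivity D_T μ_T T` with `(μ_T, D_T)` chosen from
(iii) for `T > 0` (`κ T := 1` otherwise), `κ T > 0` by `HasGreenKubo.pos`, then
`fouriersLaw_of_steadyState_and_linearResponse`. [folklore] -/
theorem fouriersLaw_of_ness_greenKubo_thermodynamicLimit :
    (∀ ω₂ lam β γ : ℝ, 0 < ω₂ → 0 < lam → 0 < β → 0 < γ → ∀ (N : ℕ) (T_L T_R : ℝ), 0 < T_L → 0 < T_R → ∃ μ : MeasureTheory.Measure (Literature.MathematicalPhysics.KineticTheory.HeatConduction.PhaseSpace N), (Literature.MathematicalPhysics.KineticTheory.HeatConduction.pinnedChain ω₂ lam β γ).IsSteadyState N T_L T_R μ ∧ ∀ ν : MeasureTheory.Measure (Literature.MathematicalPhysics.KineticTheory.HeatConduction.PhaseSpace N), (Literature.MathematicalPhysics.KineticTheory.HeatConduction.pinnedChain ω₂ lam β γ).IsSteadyState N T_L T_R ν → ν = μ) → (∀ ω₂ lam β γ : ℝ, 0 < ω₂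 → 0 < lam → 0 < β → 0 < γ → ∀ T : ℝ, 0 < T → ∃ μ : MeasureTheory.Measure Literature.MathematicalPhysics.KineticTheory.HeatConduction.ChainConfig, (Literature.MathematicalPhysics.KineticTheory.HeatConduction.pinnedChain ω₂ lam β γ).IsChainGibbsMeasure T μ ∧ ∃ D : Literature.MathematicalPhysics.KineticTheory.HeatConduction.InfiniteChainDynamics (Literature.MathematicalPhysics.KineticTheory.HeatConduction.pinnedChain ω₂ lam β γ), D.PreservesMeasure μ ∧ D.HasGreenKubo μ T) → (∀ ω₂ lam β γ : ℝ, 0 < ω₂ → 0 < lam → 0 < β → 0 < γ → (∀ (N : ℕ) (T_L T_R : ℝ), 0 < T_L → 0 < T_R → ∀ μ ν : MeasureTheory.Measure (Literature.MathematicalPhysics.KineticTheory.HeatConduction.PhaseSpace N), (Literature.MathematicalPhysics.KineticTheory.HeatConduction.pinnedChain ω₂ lam β γ).IsSteadyState N T_L T_R μ → (Literature.MathematicalPhysics.KineticTheory.HeatConduction.pinnedChain ω₂ lam β γ).IsSteadyState N T_L T_R ν → μ = ν) → ∀ μ : (N : ℕ) → ℝ → ℝ → MeasureTheory.Measure (Literature.MathematicalPhysics.KineticTheory.HeatConduction.PhaseSpace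 N), (∀ (N : ℕ) (T_L T_R : ℝ), 0 < T_L → 0 < T_R → (Literature.MathematicalPhysics.KineticTheory.HeatConduction.pinnedChain ω₂ lam β γ).IsSteadyState N T_L T_R (μ N T_L T_R)) → ∀ T : ℝ, 0 < T → ∀ (μT : MeasureTheory.Measure Literature.MathematicalPhysics.KineticTheory.HeatConduction.ChainConfig) (D : Literature.MathematicalPhysics.KineticTheory.HeatConduction.InfiniteChainDynamics (Literature.MathematicalPhysics.KineticTheory.HeatConduction.pinnedChain ω₂ lam β γ)), (Literature.MathematicalPhysics.KineticTheory.HeatConduction.pinnedChain ω₂ lam β γ).IsChainGibbsMeasure T μT → D.PreservesMeasure μT → D.HasGreenKubo μT T → ∃ Dn : ℕ → ℝ, (∀ N : ℕ, Filter.Tendsto (fun δ : ℝ => (Literature.MathematicalPhysics.KineticTheory.HeatConduction.pinnedChain ω₂ lam β γ).totalCurrent (μ N (T + δ / 2) (T - δ / 2)) / δ) (nhdsWithin 0 {(0 : ℝ)}ᶜ) (nhds (Dn N))) ∧ Filter.Tendsto Dn Filter.atTop (nhds (D.greenKuboConductivity μT T))) → Literature.MathematicalPhysics.KineticTheory.HeatConduction.FouriersLaw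 := by
  intro h₁ h₃ h₄
  refine Literature.HeatConduction.fouriersLaw_of_steadyState_and_linearResponse h₁ ?_
  intro ω₂ lam β γ hω hl hβ hγ
  have huniq : ∀ (N : ℕ) (T_L T_R : ℝ), 0 < T_L → 0 < T_R →
      ∀ μ ν : MeasureTheory.Measure (Literature.MathematicalPhysics.KineticTheory.HeatConduction.PhaseSpace N),
        (Literature.MathematicalPhysics.KineticTheory.HeatConduction.pinnedChain ω₂ lam β γ).IsSteadyState N T_L T_R μ →
        (Literature.MathematicalPhysics.KineticTheory.HeatConduction.pinnedChain ω₂ lam β γ).IsSteadyState N T_L T_R ν → μ = ν := by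
    intro N T_L T_R hL hR μ ν hμ hν
    obtain ⟨ρ, _, hρ⟩ := h₁ ω₂ lam β γ hω hl hβ hγ N T_L T_R hL hR
    exact (hρ μ hμ).trans (hρ ν hν).symm
  have hGK := h₃ ω₂ lam β γ hω hl hβ hγ
  classical
  -- the Gibbs state and the dynamics chosen from (iii), for `T > 0`
  let μT : ∀ T : ℝ, 0 < T → MeasureTheory.Measure Literature.MathematicalPhysics.KineticTheory.HeatConduction.ChainConfig :=
    fun T hT => Classical.choose (hGK T hT)
  have hμT : ∀ (T : ℝ) (hT : 0 < T),
      (Literature.MathematicalPhysics.KineticTheory.HeatConduction.pinnedChain ω₂ lam β γ).IsChainGibbsMeasure T (μT T hT) ∧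
      ∃ D : Literature.MathematicalPhysics.KineticTheory.HeatConduction.InfiniteChainDynamics (Literature.MathematicalPhysics.KineticTheory.HeatConduction.pinnedChain ω₂ lam β γ),
        D.PreservesMeasure (μT T hT) ∧ D.HasGreenKubo (μT T hT) T :=
    fun T hT => Classical.choose_spec (hGK T hT)
  let DT : ∀ T : ℝ, 0 < T →
      Literature.MathematicalPhysics.KineticTheory.HeatConduction.InfiniteChainDynamics (Literature.MathematicalPhysics.KineticTheory.HeatConduction.pinnedChain ω₂ lam β γ) :=
    fun T hT => Classical.choose (hμT T hT).2
  have hDT : ∀ (T : ℝ) (hT : 0 < T),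
      (DT T hT).PreservesMeasure (μT T hT) ∧ (DT T hT).HasGreenKubo (μT T hT) T :=
    fun T hT => Classical.choose_spec (hμT T hT).2
  refine ⟨fun T => if hT : 0 < T then (DT T hT).greenKuboConductivity (μT T hT) T else 1, ?_, ?_⟩
  · intro T hT
    simp only [dif_pos hT]
    exact (hDT T hT).2.pos
  · intro μ hμ T hT
    obtain ⟨Dn, hDn, hlim⟩ := h₄ ω₂ lam β γ hω hl hβ hγ huniq μ hμ T hT (μT T hT) (DT T hT)
      (hμT T hT).1 (hDT T hT).1 (hDT T hT).2
    refine ⟨Dn, hDn, ?_⟩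
    simp only [dif_pos hT]
    exact hlim

end Literature.HeatConduction
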